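import Literature.AlgebraicGeometry.Motives.MixedHodgeStructureCatRigid
import HarnessLib

/-!
# The categorical trace in `MixedHodgeStructureCat`: `tr(f) = ev ∘ β ∘ (f ⊗ 1) ∘ δ : ℚ(0) → ℚ(0)` is the trace of the underlying linear map

Layer `Literature/AlgebraicGeometry/Motives` (lane `lit-hodgefound`), continuing g45-#17 (`coevHom X = δ_X : ℚ(0) → X ⊗ X^∨`, `evalPairing X = ev_X : X^∨ ⊗ X → ℚ(0)`,
`coevHom_braiding_evalPairing : δ ≫ β ≫ ev = dim X · 𝟙`).  Deligne–Milne §1 (1.7.3)–(1.7.5): in a rigid tensor category the TRACE of `f : X → X` is the endomorphism of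
`𝟙` given by `𝟙 → X ⊗ X^∨ → X ⊗ X^∨ → X^∨ ⊗ X → 𝟙` (`δ`, `f ⊗ 1`, the symmetry, `ev`), and the RANK of `X` is `tr(𝟙_X)`; for `ℚ`-vector spaces this is the usual trace.
This file PROVES it for finite-dimensional mixed Hodge structures:

* §1 linear algebra: `(f ⊗ 1) ∘ σ = σ ∘ (1 ⊗ f)`, `ev` is the contraction, `dualTensorHom ∘ (1 ⊗ f) = f ∘ dualTensorHom`, and `ev(σ? (1 ⊗ f) δ) = tr f`;
* §2 **`traceHom f : ℚ(0) ⟶ ℚ(0)`** and **`traceHom_eq : traceHom f = (tr f) · 𝟙_{ℚ(0)}`** (`tr` = `LinearMap.trace ℚ X f`), `traceHom (𝟙 X) = dim X · 𝟙`;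
* §3 the trace calculus in the category, from Mathlib's: `tr(f ≫ g) = tr(g ≫ f)`, additivity and linearity, **`tr(f ⊗ g) = tr f · tr g`**, `tr(f^∨) = tr f`, `tr(f(j)) = tr f`.

Everything is PROVED; no named fact, no instance, no notation.  Data: `traceHom`.

Sources, verbatim (through the tree's files and Mathlib).  P. Deligne, J. S. Milne, *Tannakian categories*, in LNM 900 (1982) [DeligneMilne1982Tannakian], §1 (1.7.3)–(1.7.5)
(`Tr_X(f)`, `rk(X) := Tr_X(id_X)`; the formulas `Tr(f ⊗ g) = Tr(f) Tr(g)`, `rk(X ⊗ Y) = rk X · rk Y`), Ex. 1.10 (Hodge structures).  P. Deligne, *Théorie de Hodge II* (1971)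
[DeligneHodgeII1971], 2.3.5–2.3.7 (the fibre functor «espace vectoriel sous-jacent», faithful exact ⊗).

## Main results

* §1 `tensorHom_id_toLinearMap_comm`, `evalPairing_toLinearMap_eq_contractLeft`, `dualTensorHom_lTensor`, `contractLeft_lTensor_coevTensor`.
* §2 **`traceHom`**, **`traceHom_toLinearMap_apply`**, **`traceHom_eq`**, `traceHom_id`.
* §3 **`traceHom_comp_comm`**, `traceHom_add`, `traceHom_smul`, `traceHom_zero`, **`traceHom_tensorHom`**, **`traceHom_transposeHom`**, `traceHom_tateTwist_map`.

## References

* [DeligneMilne1982Tannakian] P. Deligne, J. S. Milne, Tannakian categories, in LNM 900 (1982), §1 (1.7.3)–(1.7.5), Ex. 1.10.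
* [DeligneHodgeII1971] P. Deligne, Théorie de Hodge II, Publ. Math. IHÉS 40 (1971), 2.3.5–2.3.7.

## Provenance

Lane `lit-hodgefound` (summit `HodgeConjecture`), seat `lit-hodgefound-p36` (literature-prover, generation 45, row g45-#25).
-/

noncomputable section

open CategoryTheory CategoryTheory.Limits
open scoped TensorProduct

namespace Literature.AlgebraicGeometry.Motives

universe u

namespace MixedHodgeStructureCat

variable {X Y : MixedHodgeStructureCat.{u}} [Module.Finite ℚ X] [Module.Finite ℚ Y]

/-! ## §1 Linear algebra -/

/-- `(f ⊗ 1)(σ t) = σ((1 ⊗ f) t)` for `t ∈ X^∨ ⊗ X` (`σ` the flip `X^∨ ⊗ X ≅ X ⊗ X^∨`). [cite: DeligneMilne1982Tannakian, §1 (1.7.3)] -/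
theorem tensorHom_id_toLinearMap_comm (f : X ⟶ X) (t : ↥(tensorObj (of X.str.dual) X)) :
    (tensorHom f (𝟙 (of X.str.dual))).toLinearMap (TensorProduct.comm ℚ (Module.Dual ℚ X) X t) =
      TensorProduct.comm ℚ (Module.Dual ℚ X) X (LinearMap.lTensor (Module.Dual ℚ X) f.toLinearMap t) := by
  induction t using TensorProduct.induction_on with
  | zero => simp only [map_zero]
  | tmul φ x => rw [TensorProduct.comm_tmul, tensorHom_toLinearMap_apply_tmul, LinearMap.lTensor_tmul, TensorProduct.comm_tmul]; rfl
  | add t₁ t₂ h₁ h₂ => simp only [map_add, h₁, h₂]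

variable (X) in
/-- `ev_X` is the contraction `φ ⊗ x ↦ φ(x)` (into `ℚ(0) = ULift ℚ`). [cite: DeligneMilne1982Tannakian, §1 (1.6.5)] -/
theorem evalPairing_toLinearMap_eq_contractLeft (s : ↥(tensorObj (of X.str.dual) X)) : (evalPairing X).toLinearMap s = ULift.up (contractLeft ℚ X s) := by
  induction s using TensorProduct.induction_on with
  | zero => simp only [map_zero]; rfl
  | tmul φ x => rw [evalPairing_toLinearMap_apply_tmul, contractLeft_apply]
  | add t₁ t₂ h₁ h₂ => rw [map_add, map_add, h₁, h₂]; rfl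

omit [Module.Finite ℚ X] in
/-- `dualTensorHom ((1 ⊗ f) t) = f ∘ dualTensorHom t`. [cite: DeligneMilne1982Tannakian, §1 (1.7.3)] -/
theorem dualTensorHom_lTensor (f : X →ₗ[ℚ] X) (t : Module.Dual ℚ X ⊗[ℚ] X) :
    dualTensorHom ℚ X X (LinearMap.lTensor (Module.Dual ℚ X) f t) = f ∘ₗ dualTensorHom ℚ X X t := by
  induction t using TensorProduct.induction_on with
  | zero => simp only [map_zero, LinearMap.comp_zero]
  | tmul φ x =>
    rw [LinearMap.lTensor_tmul]
    refine LinearMap.ext fun v => ?_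
    rw [dualTensorHom_apply, LinearMap.comp_apply, dualTensorHom_apply, map_smul]
  | add t₁ t₂ h₁ h₂ => simp only [map_add, h₁, h₂, LinearMap.comp_add]

variable (X) in
/-- **`ev((1 ⊗ f) δ) = tr f`**: contracting `Σᵢ eᵢ^* ⊗ f(eᵢ)` gives the trace (`tr = contraction ∘ (End X ≅ X^∨ ⊗ X)`). [cite: DeligneMilne1982Tannakian, §1 (1.7.3)–(1.7.5)] -/
theorem contractLeft_lTensor_coevTensor (f : X →ₗ[ℚ] X) :
    contractLeft ℚ X (LinearMap.lTensor (Module.Dual ℚ X) f (coevTensor X)) = LinearMap.trace ℚ X f := by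
  rw [← LinearMap.trace_eq_contract_apply, dualTensorHom_lTensor, dualTensorHom_coevTensor, LinearMap.comp_id]

/-! ## §2 The categorical trace -/

/-- **The categorical trace `tr(f) : ℚ(0) → X ⊗ X^∨ → X ⊗ X^∨ → X^∨ ⊗ X → ℚ(0)`** of an endomorphism `f : X ⟶ X` (`δ`, `f ⊗ 1`, the symmetry, `ev`).
[cite: DeligneMilne1982Tannakian, §1 (1.7.3)] -/
def traceHom (f : X ⟶ X) : unitObj.{u} ⟶ unitObj.{u} :=
  coevHom X ≫ tensorHom f (𝟙 (of X.str.dual)) ≫ (braiding X (of X.str.dual)).hom ≫ evalPairing X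

/-- **`tr(f)(q) = q · trace(f)`.** [cite: DeligneMilne1982Tannakian, §1 (1.7.3)–(1.7.5)] -/
theorem traceHom_toLinearMap_apply (f : X ⟶ X) (q : unitObj.{u}) : (traceHom f).toLinearMap q = ULift.up (q.down * LinearMap.trace ℚ X f.toLinearMap) := by
  change (evalPairing X).toLinearMap ((braiding X (of X.str.dual)).hom.toLinearMap ((tensorHom f (𝟙 (of X.str.dual))).toLinearMap ((coevHom X).toLinearMap q))) = _
  rw [coevHom_toLinearMap_apply, map_smul, tensorHom_id_toLinearMap_comm, map_smul, map_smul]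
  have hβ : (braiding X (of X.str.dual)).hom.toLinearMap
      (TensorProduct.comm ℚ (Module.Dual ℚ X) X (LinearMap.lTensor (Module.Dual ℚ X) f.toLinearMap (coevTensor X))) =
        LinearMap.lTensor (Module.Dual ℚ X) f.toLinearMap (coevTensor X) :=
    (TensorProduct.comm ℚ (Module.Dual ℚ X) X).symm_apply_apply _
  rw [hβ, evalPairing_toLinearMap_eq_contractLeft, contractLeft_lTensor_coevTensor]
  rfl

/-- **`tr(f) = trace(f) · 𝟙_{ℚ(0)}`**: the categorical trace of Deligne–Milne is the trace of the underlying linear map. [cite: DeligneMilne1982Tannakian, §1 (1.7.3)–(1.7.5)] -/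
theorem traceHom_eq (f : X ⟶ X) : traceHom f = (LinearMap.trace ℚ X f.toLinearMap) • 𝟙 unitObj.{u} := by
  apply hom_ext
  refine LinearMap.ext fun q => ?_
  rw [traceHom_toLinearMap_apply]
  apply ULift.ext
  change q.down * LinearMap.trace ℚ X f.toLinearMap = LinearMap.trace ℚ X f.toLinearMap * q.down
  exact mul_comm _ _

variable (X) in
/-- **`tr(𝟙_X) = dim X · 𝟙`**: the rank of `X` is its dimension (g45-#17 `coevHom_braiding_evalPairing`). [cite: DeligneMilne1982Tannakian, §1 (1.7.4)] -/
theorem traceHom_id : traceHom (𝟙 X) = (Module.finrank ℚ X : ℚ) • 𝟙 unitObj.{u} := by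
  rw [traceHom_eq]
  change LinearMap.trace ℚ X LinearMap.id • _ = _
  rw [LinearMap.trace_id]

/-! ## §3 The trace calculus -/

/-- **`tr(f ≫ g) = tr(g ≫ f)`** for `f : X → Y`, `g : Y → X`. [cite: DeligneMilne1982Tannakian, §1 (1.7.5)] -/
theorem traceHom_comp_comm (f : X ⟶ Y) (g : Y ⟶ X) : traceHom (f ≫ g) = traceHom (g ≫ f) := by
  rw [traceHom_eq, traceHom_eq, comp_toLinearMap, comp_toLinearMap, LinearMap.trace_comp_comm']

/-- `tr(f + g) = tr f + tr g`. [cite: DeligneMilne1982Tannakian, §1 (1.7.5)] -/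
theorem traceHom_add (f g : X ⟶ X) : traceHom (f + g) = traceHom f + traceHom g := by
  rw [traceHom_eq, traceHom_eq, traceHom_eq, ← add_smul]
  congr 1
  exact map_add (LinearMap.trace ℚ X) f.toLinearMap g.toLinearMap

/-- `tr(c • f) = c • tr f`. [cite: DeligneMilne1982Tannakian, §1 (1.7.5)] -/
theorem traceHom_smul (c : ℚ) (f : X ⟶ X) : traceHom (c • f) = c • traceHom f := by
  rw [traceHom_eq, traceHom_eq, smul_smul]
  congr 1
  exact map_smul (LinearMap.trace ℚ X) c f.toLinearMap

variable (X) in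
/-- `tr(0) = 0`. [cite: DeligneMilne1982Tannakian, §1 (1.7.5)] -/
theorem traceHom_zero : traceHom (0 : X ⟶ X) = 0 := by
  rw [traceHom_eq]
  change LinearMap.trace ℚ X 0 • _ = _
  rw [map_zero, zero_smul]

/-- **`tr(f ⊗ g) = tr f · tr g`.** [cite: DeligneMilne1982Tannakian, §1 (1.7.5)] -/
theorem traceHom_tensorHom (f : X ⟶ X) (g : Y ⟶ Y) :
    traceHom (tensorHom f g) = (LinearMap.trace ℚ X f.toLinearMap * LinearMap.trace ℚ Y g.toLinearMap) • 𝟙 unitObj.{u} := by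
  rw [traceHom_eq, ← LinearMap.trace_tensorProduct']
  rfl

/-- **`tr(f^∨) = tr f`** (the transpose has the same trace). [cite: DeligneMilne1982Tannakian, §1 (1.7.5)] -/
theorem traceHom_transposeHom (f : X ⟶ X) : traceHom (transposeHom f) = traceHom f := by
  rw [traceHom_eq, traceHom_eq, transposeHom_toLinearMap]
  congr 1
  exact LinearMap.trace_transpose' f.toLinearMap

/-- `tr(f(j)) = tr f` for the Tate twist (same underlying map). [cite: DeligneHodgeII1971, 2.3.7] -/
theorem traceHom_tateTwist_map (j : ℤ) (f : X ⟶ X) :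
    haveI : Module.Finite ℚ ((tateTwist j).obj X) := ‹Module.Finite ℚ X›
    traceHom ((tateTwist j).map f) = (LinearMap.trace ℚ X f.toLinearMap) • 𝟙 unitObj.{u} := by
  haveI : Module.Finite ℚ ((tateTwist j).obj X) := ‹Module.Finite ℚ X›
  exact traceHom_eq _

end MixedHodgeStructureCat

end Literature.AlgebraicGeometry.Motives
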